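import Summits.CriticalPhenomena.PercolationContinuityZ3.Theorems.Transplant.FreeNilpotentPointGroup
import Mathlib.Algebra.Group.MinimalAxioms
import HarnessLib

/-!
# The free 2-step nilpotent group `N_{m,2}` (`FN m`) as a Mathlib `Group`

builds on p205010 (kernel theorem, internal audit signed; external expert review pending) — nothing in this file uses p205010.
Lane `prim-bschramm`, seat `prim-bschramm-p4` gen 10 (PART C3 of `P4-GENERAL.md`).  Helper file (`--supports stmt-CriticalPhenomena-4575 --as helper`).

The tree's `FN m = (Fin m → ℤ) × (Pr m → ℤ)` with `fnMul` (`FreeNilpotentGroup.lean`) carries no `Group` instance (its Cayley graph `fnGraph` is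
built by hand).  This file puts Mathlib's `Group` structure on the type synonym `FreeNilNG.NG m` (laws `fnMul_assoc`, `fnMul_zero_left`,
`fnInv_mul` from the tree), so that `mulCayley`, `Subgroup.closure`, `MulEquiv` … become available: central elements `cen`, their powers,
the splitting `of (v, c) = of (v, 0) * cen c`, powers of free generators, and the sign automorphisms `signAut ε` (`signMap` of
`FreeNilpotentPointGroup.lean`) as `MulEquiv`s.
-/

noncomputable section

namespace Summit.CriticalPhenomena.PercolationContinuityZ3.Theorems.Transplant

namespace FreeNilNG

open scoped Classical

variable {m : ℕ}

/-! ## §1 `N_{m,2}` as a Mathlib group -/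

/-- The free 2-step nilpotent group `N_{m,2}` as a type synonym of the tree's `FN m` (to carry a `Group` instance). [folklore] -/
def NG (m : ℕ) : Type := FN m

namespace NG

/-- From `FN m`. [folklore] -/
def of (x : FN m) : NG m := x

/-- To `FN m`. [folklore] -/
def val (g : NG m) : FN m := g

/-- `val (of x) = x`. [folklore] -/
@[simp] theorem val_of (x : FN m) : val (of x : NG m) = x := rfl

/-- `of (val g) = g`. [folklore] -/
@[simp] theorem of_val (g : NG m) : of (val g) = g := rfl

/-- `val` is injective. [folklore] -/
theorem val_injective : Function.Injective (val : NG m → FN m) := fun _ _ h => h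

/-- Multiplication = `fnMul`. [folklore] -/
instance instMul : Mul (NG m) := ⟨fun a b => of (fnMul (val a) (val b))⟩
/-- Unit = `0`. [folklore] -/
instance instOne : One (NG m) := ⟨of 0⟩
/-- Inversion = `fnInv`. [folklore] -/
instance instInv : Inv (NG m) := ⟨fun a => of (fnInv (val a))⟩

/-- `val (a * b) = fnMul (val a) (val b)`. [folklore] -/
@[simp] theorem val_mul (a b : NG m) : val (a * b) = fnMul (val a) (val b) := rfl

/-- `val 1 = 0`. [folklore] -/
@[simp] theorem val_one : val (1 : NG m) = 0 := rfl

/-- `val a⁻¹ = fnInv (val a)`. [folklore] -/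
@[simp] theorem val_inv (a : NG m) : val a⁻¹ = fnInv (val a) := rfl

/-- **`N_{m,2}` is a group** (laws from `FreeNilpotentGroup.lean`). [folklore] -/
instance instGroup : Group (NG m) :=
  Group.ofLeftAxioms (fun a b c => val_injective (by simp [fnMul_assoc])) (fun a => val_injective (by simp))
    (fun a => val_injective (by simp))

/-- `val (a * b) = fnMul …` for the group multiplication. [folklore] -/
@[simp] theorem val_mul' (a b : NG m) : val (a * b) = fnMul (val a) (val b) := rfl

/-- First coordinates add. [folklore] -/
theorem fst_mul (a b : NG m) : (val (a * b)).1 = (val a).1 + (val b).1 := rfl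

/-- Central elements. [folklore] -/
def cen (c : Pr m → ℤ) : NG m := of (0, c)

/-- Central elements multiply by addition. [folklore] -/
theorem cen_mul_cen (c c' : Pr m → ℤ) : (cen c * cen c' : NG m) = cen (c + c') :=
  val_injective (by simp [cen, fnMul_central_left])

/-- `cen 0 = 1`. [folklore] -/
theorem cen_zero : (cen 0 : NG m) = 1 := rfl

/-- Inverse of a central element. [folklore] -/
theorem cen_inv (c : Pr m → ℤ) : (cen c : NG m)⁻¹ = cen (-c) := by
  rw [inv_eq_iff_mul_eq_one, cen_mul_cen, add_neg_cancel, cen_zero]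

/-- Integer powers of central elements. [folklore] -/
theorem cen_zpow (c : Pr m → ℤ) (a : ℤ) : (cen c : NG m) ^ a = cen (a • c) := by
  induction a using Int.induction_on with
  | zero => rw [zpow_zero, zero_smul, cen_zero]
  | succ n ih => rw [zpow_add_one, ih, cen_mul_cen, add_smul, one_smul]
  | pred n ih => rw [zpow_sub_one, ih, cen_inv, cen_mul_cen, sub_smul, one_smul, sub_eq_add_neg]

/-- A product splits off its central part. [folklore] -/
theorem of_eq_mul_cen (v : Fin m → ℤ) (c : Pr m → ℤ) : (of (v, c) : NG m) = of (v, 0) * cen c :=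
  val_injective (by simp [cen, fnMul_central_right])

/-- Powers of a free generator have no central part. [folklore] -/
theorem gen_zpow (i : Fin m) (a : ℤ) : (of (fnGen i) : NG m) ^ a = of (Pi.single i a, 0) := by
  have key : ∀ a : ℤ, (of (Pi.single i a, (0 : Pr m → ℤ)) : NG m) * of (fnGen i) = of (Pi.single i (a + 1), 0) := by
    intro a
    apply val_injective
    refine Prod.ext (funext fun j => ?_) (funext fun q => ?_)
    · simp only [val_mul', val_of, fnMul_fst, fnGen_fst, Pi.add_apply, Pi.single_apply]
      split_ifs <;> ring
    · simp only [val_mul', val_of, fnMul_snd, fnGen_snd, Pi.add_apply, Pi.zero_apply, zero_add, fnBeta_apply, fnGen_fst,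
        Pi.single_apply]
      have hq : q.1.1 ≠ q.1.2 := ne_of_lt q.2
      by_cases h1 : q.1.1 = i
      · have h2 : q.1.2 ≠ i := fun h => hq (h1.trans h.symm)
        simp [h2]
      · simp [h1]
  induction a using Int.induction_on with
  | zero => apply val_injective; refine Prod.ext ?_ ?_ <;> simp
  | succ n ih => rw [zpow_add_one, ih, key]
  | pred n ih =>
    rw [zpow_sub_one, ih]
    have e := key (-(n : ℤ) - 1)
    rw [show -(n : ℤ) - 1 + 1 = -n by ring] at e
    rw [← e, mul_inv_cancel_right]

/-- First coordinate of `of (v, 0) * of (w, c)`. [folklore] -/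
theorem of_mul_of_fst (v w : Fin m → ℤ) (c c' : Pr m → ℤ) : (val ((of (v, c) : NG m) * of (w, c'))).1 = v + w := rfl

end NG

namespace NG

/-- The sign automorphism `a_i ↦ a_i^{ε_i}` as a `MulEquiv` of `N_{m,2}`. [cite: KozmaNitzan2024, §4 p. 16 (Lemma 8)] -/
def signAut (ε : Fin m → ℤˣ) : NG m ≃* NG m where
  toFun := fun g => of (signMap ε (val g))
  invFun := fun g => of (signMap ε (val g))
  left_inv := fun g => val_injective (by simp [signMap_signMap])
  right_inv := fun g => val_injective (by simp [signMap_signMap])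
  map_mul' := fun a b => val_injective (by simp [signMap_fnMul])

/-- `val (signAut ε g) = signMap ε (val g)`. [folklore] -/
@[simp] theorem val_signAut (ε : Fin m → ℤˣ) (g : NG m) : val (signAut ε g) = signMap ε (val g) := rfl

/-- `signMap` on a basic commutator: a sign. [folklore] -/
theorem signMap_cen_single (ε : Fin m → ℤˣ) (q : Pr m) (a : ℤ) :
    signAut ε (cen (Pi.single q a) : NG m) = cen (Pi.single q ((ε q.1.1 : ℤ) * (ε q.1.2 : ℤ) * a)) := by
  apply val_injective
  refine Prod.ext (funext fun j => by simp [cen]) (funext fun q' => ?_)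
  simp only [val_signAut, cen, val_of, signMap_snd, Pi.single_apply]
  split_ifs with h
  · subst h; rfl
  · ring

end NG

end FreeNilNG

end Summit.CriticalPhenomena.PercolationContinuityZ3.Theorems.Transplant

end
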